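import Mathlib
import Literature.NumberTheory.Transcendental.KZProduct
import Literature.NumberTheory.Transcendental.KZProductIdeal
import Literature.NumberTheory.Transcendental.KZCalculusProofs
import Literature.NumberTheory.Transcendental.KZSemialgebraicComplex
import Literature.NumberTheory.Transcendental.KZVolumeConjectureProofs
import Summits.KontsevichZagierPeriods.KontsevichZagierPeriods.Theorems.SoloInformedVolumeLadder
import HarnessLib
import HarnessLib.Audit

/-!
# SoloInformed — the hyperbolic box is a product of two Kummer periods

The naive side of the Theorem II instance of the residency paper (§3, corrected s16). For natural
numbers `a, b` let

* `L_a = [[1, a], 1/x]` (`soloInformedKummerRep a`, value `log a`), the Kummer `1`-period, and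
* `B(a,b) = {1 ≤ x ≤ a, 1 ≤ y ≤ b, 0 ≤ z, xyz ≤ 1} ⊂ ℝ³` (`soloInformedKummerBoxRep a b`), a compact
  `ℚ`-semialgebraic solid with integrand `1` and volume `log a · log b`.

Inside the four-move calculus, ONE Newton–Leibniz move along `z` (primitive `F = z`, upper limit
`1/(xy)`) gives

  `soloInformed_kummerBox_equivalent_prod :  [B(a,b), 1] ∼ [L_a × L_b] = [L_a] · [L_b]`,

so `vol B(a,b) = log a · log b` (`soloInformed_value_kummerBoxRep`), and volume rung `3`
(`SoloInformedVolumeRung 3`) would make EVERY compact `ℚ`-semialgebraic solid with non-empty interior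
and volume `log a · log b` move-equivalent to the product of Kummer periods `[L_a] · [L_b]`
(`soloInformed_equivalent_kummer_prod_of_rung_three`). With `SoloInformedPappus` (a solid torus is
`∼ [D̄] · [Λ]`, carrying the factor `[D̄]` of value `π`) this pins both sides of the instance
"solid torus (`4π²`) against `B(2,3)` (`log 2 · log 3`)": `Rung_3` would turn a rational relation
`p · 4π² = q · log 2 · log 3` into a move-equivalence between a multiple of `[D̄]·[Λ]` and a multiple of
`[L₂]·[L₃]`, which the formal period ring forbids (paper §3; the transcendence statement
`π² ∉ ℚ · log 2 · log 3` itself is the case `(2,3)` of the weak four-exponentials conjecture, open).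

Residency `solo-KontsevichZagierPeriods-informed` (PLAN.md, session s16).
References: M. Kontsevich, D. Zagier, *Periods* (2001), §1.1–§1.2.
-/

noncomputable section

open MeasureTheory Set Filter
open scoped Topology

namespace Summit.KontsevichZagierPeriods.KontsevichZagierPeriods.Theorems

open Literature.NumberTheory.Transcendental Literature.NumberTheory.Transcendental.KZ
open Literature.ModelTheory.ExponentialFields (IsSemialgebraic isSemialgebraic_setOf_eval_le
  isSemialgebraic_setOf_eval_lt)

/-! ### The Kummer period `L_a = [[1, a], 1/x]` -/

/-- The interval `[1, a] ⊂ ℝ¹`. -/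
def soloInformedKummerDom (a : ℕ) : Set (Fin 1 → ℝ) := {x | 1 ≤ x 0 ∧ x 0 ≤ (a : ℝ)}

/-- `[1, a]` is `ℚ`-semialgebraic. -/
theorem isSemialgebraic_soloInformedKummerDom (a : ℕ) : IsSemialgebraic ℚ (soloInformedKummerDom a) := by
  have h1 := isSemialgebraic_setOf_eval_le (k := ℚ) (R := ℝ) (1 : MvPolynomial (Fin 1) ℚ)
    (MvPolynomial.X 0)
  have h2 := isSemialgebraic_setOf_eval_le (k := ℚ) (R := ℝ) (MvPolynomial.X 0)
    ((a : ℕ) : MvPolynomial (Fin 1) ℚ)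
  simp only [map_one, MvPolynomial.aeval_X, map_natCast] at h1 h2
  exact h1.inter h2

/-- `[1, a] ⊂ ℝ¹` is an order interval, hence compact. -/
theorem isCompact_soloInformedKummerDom (a : ℕ) : IsCompact (soloInformedKummerDom a) := by
  have h : soloInformedKummerDom a = Icc (fun _ => (1 : ℝ)) (fun _ => (a : ℝ)) := by
    ext x
    simp [soloInformedKummerDom, Pi.le_def, Fin.forall_fin_one]
  rw [h]
  exact isCompact_Icc

/-- A coordinate function is `ℚ`-semialgebraic on a `ℚ`-semialgebraic set. -/
theorem soloInformed_isSemialgebraicFunOn_apply {m : ℕ} {s : Set (Fin m → ℝ)}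
    (hs : IsSemialgebraic ℚ s) (i : Fin m) : IsSemialgebraicFunOn ℚ s (fun x => x i) :=
  (isSemialgebraicFunOn_aeval hs (MvPolynomial.X i)).congr fun x _ => by simp

/-- **The Kummer period** `L_a = [[1, a], 1/x]`, an integral representation of dimension `1`
(value `log a`). -/
def soloInformedKummerRep (a : ℕ) : IntegralRep 1 where
  domain := soloInformedKummerDom a
  integrand x := (x 0)⁻¹
  isSemialgebraic_domain := isSemialgebraic_soloInformedKummerDom a
  isSemialgebraicFunOn_integrand :=
    (soloInformed_isSemialgebraicFunOn_apply (isSemialgebraic_soloInformedKummerDom a) 0).inv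
      fun _ hx => ne_of_gt (lt_of_lt_of_le one_pos hx.1)
  integrableOn :=
    ((continuous_apply 0).continuousOn.inv₀ fun _ hx => ne_of_gt (lt_of_lt_of_le one_pos hx.1)
      ).integrableOn_compact (isCompact_soloInformedKummerDom a)

/-- Domain of `L_a`. -/
@[simp] theorem soloInformedKummerRep_domain (a : ℕ) :
    (soloInformedKummerRep a).domain = soloInformedKummerDom a := rfl

/-- Integrand of `L_a`. -/
@[simp] theorem soloInformedKummerRep_integrand (a : ℕ) :
    (soloInformedKummerRep a).integrand = fun x => (x 0)⁻¹ := rfl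

/-- `value L_a = log a` (`a ≥ 1`). -/
theorem soloInformed_value_kummerRep (a : ℕ) (ha : 1 ≤ a) :
    (soloInformedKummerRep a).value = Real.log a := by
  have ha' : (1 : ℝ) ≤ a := by exact_mod_cast ha
  have hmp : MeasurePreserving (MeasurableEquiv.funUnique (Fin 1) ℝ) volume volume :=
    volume_preserving_funUnique (Fin 1) ℝ
  have hpre : soloInformedKummerDom a = (MeasurableEquiv.funUnique (Fin 1) ℝ) ⁻¹' Icc (1 : ℝ) a := by
    ext u
    simp [MeasurableEquiv.funUnique, soloInformedKummerDom, Fin.default_eq_zero]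
  have h1 : (soloInformedKummerRep a).value = ∫ t in Icc (1 : ℝ) a, t⁻¹ := by
    show ∫ u in soloInformedKummerDom a, (u 0)⁻¹ = _
    rw [hpre]
    exact hmp.setIntegral_preimage_emb (MeasurableEquiv.funUnique (Fin 1) ℝ).measurableEmbedding
      (fun t => t⁻¹) (Icc (1 : ℝ) a)
  rw [h1, integral_Icc_eq_integral_Ioc, ← intervalIntegral.integral_of_le ha',
    integral_inv_of_pos one_pos (lt_of_lt_of_le one_pos ha'), div_one]

/-- Membership in the product domain `[1, a] × [1, b]`. -/
theorem soloInformed_mem_kummerProd {a b : ℕ} {x : Fin 2 → ℝ}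
    (hx : x ∈ ((soloInformedKummerRep a).prod (soloInformedKummerRep b)).domain) :
    (1 ≤ x 0 ∧ x 0 ≤ (a : ℝ)) ∧ (1 ≤ x 1 ∧ x 1 ≤ (b : ℝ)) := hx

/-! ### The box `B(a,b) = {1 ≤ x ≤ a, 1 ≤ y ≤ b, 0 ≤ z, xyz ≤ 1}` -/

/-- The solid `B(a,b) = {1 ≤ x ≤ a, 1 ≤ y ≤ b, 0 ≤ z, xyz ≤ 1}` under the surface `xyz = 1`. -/
def soloInformedKummerBoxDom (a b : ℕ) : Set (Fin 3 → ℝ) :=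
  {u | (1 ≤ u 0 ∧ u 0 ≤ (a : ℝ)) ∧ (1 ≤ u 1 ∧ u 1 ≤ (b : ℝ)) ∧ (0 ≤ u 2 ∧ u 0 * u 1 * u 2 ≤ 1)}

/-- `B(a,b)` is `ℚ`-semialgebraic. -/
theorem isSemialgebraic_soloInformedKummerBoxDom (a b : ℕ) :
    IsSemialgebraic ℚ (soloInformedKummerBoxDom a b) := by
  have h1 := isSemialgebraic_setOf_eval_le (k := ℚ) (R := ℝ) (1 : MvPolynomial (Fin 3) ℚ)
    (MvPolynomial.X 0)
  have h2 := isSemialgebraic_setOf_eval_le (k := ℚ) (R := ℝ) (MvPolynomial.X 0)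
    ((a : ℕ) : MvPolynomial (Fin 3) ℚ)
  have h3 := isSemialgebraic_setOf_eval_le (k := ℚ) (R := ℝ) (1 : MvPolynomial (Fin 3) ℚ)
    (MvPolynomial.X 1)
  have h4 := isSemialgebraic_setOf_eval_le (k := ℚ) (R := ℝ) (MvPolynomial.X 1)
    ((b : ℕ) : MvPolynomial (Fin 3) ℚ)
  have h5 := isSemialgebraic_setOf_eval_le (k := ℚ) (R := ℝ) (0 : MvPolynomial (Fin 3) ℚ)
    (MvPolynomial.X 2)
  have h6 := isSemialgebraic_setOf_eval_le (k := ℚ) (R := ℝ)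
    (MvPolynomial.X 0 * MvPolynomial.X 1 * MvPolynomial.X 2) (1 : MvPolynomial (Fin 3) ℚ)
  simp only [map_one, map_zero, map_mul, MvPolynomial.aeval_X, map_natCast] at h1 h2 h3 h4 h5 h6
  exact (h1.inter h2).inter ((h3.inter h4).inter (h5.inter h6))

/-- In `B(a,b)` the last coordinate is at most `1`. -/
theorem soloInformed_kummerBox_last_le_one {a b : ℕ} {u : Fin 3 → ℝ}
    (hu : u ∈ soloInformedKummerBoxDom a b) : u 2 ≤ 1 := by
  obtain ⟨⟨h0, -⟩, ⟨h1, -⟩, h2, h3⟩ := hu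
  nlinarith [mul_nonneg (mul_nonneg (sub_nonneg.2 h0) (sub_nonneg.2 h1)) h2,
    mul_nonneg (sub_nonneg.2 h0) h2, mul_nonneg (sub_nonneg.2 h1) h2]

/-- `B(a,b)` is compact. -/
theorem isCompact_soloInformedKummerBoxDom (a b : ℕ) : IsCompact (soloInformedKummerBoxDom a b) := by
  refine Metric.isCompact_of_isClosed_isBounded ?_
    ((Metric.isBounded_Icc (fun _ : Fin 3 => (0 : ℝ)) (fun _ => (a : ℝ) + b + 1)).subset ?_)
  · exact ((isClosed_le continuous_const (continuous_apply 0)).inter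
      (isClosed_le (continuous_apply 0) continuous_const)).inter
      (((isClosed_le continuous_const (continuous_apply 1)).inter
        (isClosed_le (continuous_apply 1) continuous_const)).inter
        ((isClosed_le continuous_const (continuous_apply 2)).inter
          (isClosed_le (((continuous_apply 0).mul (continuous_apply 1)).mul (continuous_apply 2))
            continuous_const)))
  · intro u hu
    have hu2 := soloInformed_kummerBox_last_le_one hu
    obtain ⟨⟨h0, h0'⟩, ⟨h1, h1'⟩, h2, -⟩ := hu
    have ha : (0 : ℝ) ≤ a := Nat.cast_nonneg a
    have hb : (0 : ℝ) ≤ b := Nat.cast_nonneg b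
    have p0 : 0 ≤ u 0 ∧ u 0 ≤ (a : ℝ) + b + 1 := ⟨by linarith, by linarith⟩
    have p1 : 0 ≤ u 1 ∧ u 1 ≤ (a : ℝ) + b + 1 := ⟨by linarith, by linarith⟩
    have p2 : 0 ≤ u 2 ∧ u 2 ≤ (a : ℝ) + b + 1 := ⟨h2, by linarith⟩
    refine ⟨fun i => ?_, fun i => ?_⟩ <;> fin_cases i
    exacts [p0.1, p1.1, p2.1, p0.2, p1.2, p2.2]

/-- `B(a,b)` has non-empty interior (`a, b ≥ 2`). -/
theorem soloInformed_interior_kummerBoxDom_nonempty (a b : ℕ) (ha : 2 ≤ a) (hb : 2 ≤ b) :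
    (interior (soloInformedKummerBoxDom a b)).Nonempty := by
  have ha' : (2 : ℝ) ≤ a := by exact_mod_cast ha
  have hb' : (2 : ℝ) ≤ b := by exact_mod_cast hb
  refine ⟨![5/4, 5/4, 1/10], mem_interior.2 ⟨{u | (1 < u 0 ∧ u 0 < (a : ℝ)) ∧
    (1 < u 1 ∧ u 1 < (b : ℝ)) ∧ (0 < u 2 ∧ u 0 * u 1 * u 2 < 1)}, ?_, ?_, ?_⟩⟩
  · rintro u ⟨⟨h0, h0'⟩, ⟨h1, h1'⟩, h2, h3⟩
    exact ⟨⟨h0.le, h0'.le⟩, ⟨h1.le, h1'.le⟩, h2.le, h3.le⟩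
  · exact ((isOpen_lt continuous_const (continuous_apply 0)).inter
      (isOpen_lt (continuous_apply 0) continuous_const)).inter
      (((isOpen_lt continuous_const (continuous_apply 1)).inter
        (isOpen_lt (continuous_apply 1) continuous_const)).inter
        ((isOpen_lt continuous_const (continuous_apply 2)).inter
          (isOpen_lt (((continuous_apply 0).mul (continuous_apply 1)).mul (continuous_apply 2))
            continuous_const)))
  · show (1 < (5/4 : ℝ) ∧ (5/4 : ℝ) < a) ∧ (1 < (5/4 : ℝ) ∧ (5/4 : ℝ) < b) ∧
      ((0 : ℝ) < 1/10 ∧ (5/4 : ℝ) * (5/4) * (1/10) < 1)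
    refine ⟨⟨by norm_num, by linarith⟩, ⟨by norm_num, by linarith⟩, by norm_num, by norm_num⟩

/-- **The box** `[B(a,b), 1]`, an integral representation of dimension `3`. -/
def soloInformedKummerBoxRep (a b : ℕ) : IntegralRep 3 where
  domain := soloInformedKummerBoxDom a b
  integrand _ := 1
  isSemialgebraic_domain := isSemialgebraic_soloInformedKummerBoxDom a b
  isSemialgebraicFunOn_integrand := by
    simpa using isSemialgebraicFunOn_ratCast (isSemialgebraic_soloInformedKummerBoxDom a b) 1
  integrableOn :=
    continuous_const.continuousOn.integrableOn_compact (isCompact_soloInformedKummerBoxDom a b)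

/-- Domain of the box representation. -/
@[simp] theorem soloInformedKummerBoxRep_domain (a b : ℕ) :
    (soloInformedKummerBoxRep a b).domain = soloInformedKummerBoxDom a b := rfl

/-- Integrand of the box representation. -/
@[simp] theorem soloInformedKummerBoxRep_integrand (a b : ℕ) :
    (soloInformedKummerBoxRep a b).integrand = fun _ => 1 := rfl

/-- The box representation is a volume representation of a compact solid with non-empty interior
(`a, b ≥ 2`): the hypotheses of `SoloInformedVolumeRung 3`. -/
theorem soloInformed_kummerBoxRep_isVolume (a b : ℕ) (ha : 2 ≤ a) (hb : 2 ≤ b) :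
    IsCompact (soloInformedKummerBoxRep a b).domain ∧
      (interior (soloInformedKummerBoxRep a b).domain).Nonempty ∧
      ∀ x ∈ (soloInformedKummerBoxRep a b).domain, (soloInformedKummerBoxRep a b).integrand x = 1 :=
  ⟨isCompact_soloInformedKummerBoxDom a b, soloInformed_interior_kummerBoxDom_nonempty a b ha hb,
    fun _ _ => rfl⟩

/-! ### One Newton–Leibniz move: `[B(a,b), 1] ∼ [L_a × L_b]` -/

/-- **The box is the product of two Kummer periods.** `[B(a,b), 1] − [[1,a] × [1,b], 1/(xy)] ∈
relations` by ONE Newton–Leibniz move along `z` (primitive `F = z`, limits `0 ≤ z ≤ 1/(xy)`), and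
`[[1,a] × [1,b], 1/(xy)] = L_a × L_b` is the product representation.
[Kontsevich–Zagier 2001, §1.2 (rules), §1.1 (`log 2` as a period)] -/
theorem soloInformed_kummerBox_equivalent_prod (a b : ℕ) :
    Equivalent (soloInformedKummerBoxRep a b)
      ((soloInformedKummerRep a).prod (soloInformedKummerRep b)) := by
  have hs := ((soloInformedKummerRep a).prod (soloInformedKummerRep b)).isSemialgebraic_domain
  refine newtonLeibnizRel_subset_relations ⟨2, soloInformedKummerBoxRep a b,
    (soloInformedKummerRep a).prod (soloInformedKummerRep b),
    fun _ => ((0 : ℕ) : ℝ), fun y => (y 0 * y 1)⁻¹, fun z => z (Fin.last 2),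
    soloInformed_isSemialgebraicFunOn_apply (isSemialgebraic_soloInformedKummerBoxDom a b) _,
    isSemialgebraicFunOn_natCast hs 0, ?_, ?_, ?_, ?_, ?_, ?_, rfl⟩
  · exact ((isSemialgebraicFunOn_aeval hs (MvPolynomial.X 0 * MvPolynomial.X 1)).congr
      fun x _ => by simp).inv fun x hx => by
        have h := soloInformed_mem_kummerProd hx
        exact ne_of_gt (mul_pos (lt_of_lt_of_le one_pos h.1.1) (lt_of_lt_of_le one_pos h.2.1))
  · intro x hx
    have h := soloInformed_mem_kummerProd hx
    simp only [Nat.cast_zero]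
    exact inv_nonneg.2 (mul_nonneg (by linarith [h.1.1]) (by linarith [h.2.1]))
  · ext z
    show ((1 ≤ z 0 ∧ z 0 ≤ (a : ℝ)) ∧ (1 ≤ z 1 ∧ z 1 ≤ (b : ℝ)) ∧ (0 ≤ z 2 ∧ z 0 * z 1 * z 2 ≤ 1)) ↔
      (((1 ≤ z 0 ∧ z 0 ≤ (a : ℝ)) ∧ (1 ≤ z 1 ∧ z 1 ≤ (b : ℝ))) ∧
        ((0 : ℕ) : ℝ) ≤ z 2 ∧ z 2 ≤ (z 0 * z 1)⁻¹)
    simp only [Nat.cast_zero]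
    have e : z 2 * (z 0 * z 1) = z 0 * z 1 * z 2 := by ring
    constructor
    · rintro ⟨⟨h0, h0'⟩, ⟨h1, h1'⟩, h2, h3⟩
      have hp : 0 < z 0 * z 1 := mul_pos (by linarith) (by linarith)
      refine ⟨⟨⟨h0, h0'⟩, ⟨h1, h1'⟩⟩, h2, ?_⟩
      rw [inv_eq_one_div, le_div_iff₀ hp]
      linarith
    · rintro ⟨⟨⟨h0, h0'⟩, ⟨h1, h1'⟩⟩, h2, h3⟩
      have hp : 0 < z 0 * z 1 := mul_pos (by linarith) (by linarith)
      rw [inv_eq_one_div, le_div_iff₀ hp] at h3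
      exact ⟨⟨h0, h0'⟩, ⟨h1, h1'⟩, h2, by linarith⟩
  · intro x _
    simp only [Fin.snoc_last]
    fun_prop
  · intro x _ t _
    show HasDerivAt (fun s : ℝ => (Fin.snoc x s : Fin 3 → ℝ) (Fin.last 2)) 1 t
    simp only [Fin.snoc_last]
    exact hasDerivAt_id' t
  · intro x _
    rw [IntegralRep.prod_integrand_eq, IntegralRep.prodFun_apply]
    simp only [Fin.snoc_last, Nat.cast_zero, sub_zero]
    show (x (Fin.castAdd 1 (0 : Fin 1)))⁻¹ * (x (Fin.natAdd 1 (0 : Fin 1)))⁻¹ = (x 0 * x 1)⁻¹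
    rw [mul_inv]
    rfl

/-- Ring form: `[B(a,b), 1] − [L_a] · [L_b] ∈ relations`. -/
theorem soloInformed_of_kummerBox_sub_mul_mem_relations (a b : ℕ) :
    of (soloInformedKummerBoxRep a b) - of (soloInformedKummerRep a) * of (soloInformedKummerRep b) ∈
      relations := by
  rw [of_mul_of]
  exact soloInformed_kummerBox_equivalent_prod a b

/-- `vol B(a,b) = log a · log b` (`a, b ≥ 1`), computed INSIDE the calculus: the value is a move
invariant, and the value of a product is the product of the values (Fubini). -/
theorem soloInformed_value_kummerBoxRep (a b : ℕ) (ha : 1 ≤ a) (hb : 1 ≤ b) :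
    (soloInformedKummerBoxRep a b).value = Real.log a * Real.log b := by
  rw [Equivalent.value_eq_holds (soloInformed_kummerBox_equivalent_prod a b),
    IntegralRep.value_prod, soloInformed_value_kummerRep a ha, soloInformed_value_kummerRep b hb]

/-! ### What volume rung 3 would do with it -/

/-- **Volume rung `3` and the Kummer box.** Granting `SoloInformedVolumeRung 3`, every volume
representation of a compact `ℚ`-semialgebraic solid with non-empty interior and volume
`log a · log b` (`a, b ≥ 2`) is move-equivalent to the product of Kummer periods `[L_a] · [L_b]`.
Applied (paper §3) to rational multiples of a solid torus (`∼ [D̄]·[Λ]` by `SoloInformedPappus`)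
under a hypothetical relation `p·4π² = q·log 2·log 3`, this is the move-equivalence that the formal
period ring rules out; the rung is open. -/
theorem soloInformed_equivalent_kummer_prod_of_rung_three (h3 : SoloInformedVolumeRung 3)
    (a b : ℕ) (ha : 2 ≤ a) (hb : 2 ≤ b) (r : IntegralRep 3) (hr : IsCompact r.domain)
    (hri : (interior r.domain).Nonempty) (hr1 : ∀ x ∈ r.domain, r.integrand x = 1)
    (hv : r.value = Real.log a * Real.log b) :
    of r - of (soloInformedKummerRep a) * of (soloInformedKummerRep b) ∈ relations := by
  have hB := soloInformed_kummerBoxRep_isVolume a b ha hb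
  have hE : Equivalent r (soloInformedKummerBoxRep a b) :=
    h3 r (soloInformedKummerBoxRep a b) hr hri hB.1 hB.2.1 hr1 hB.2.2
      (by rw [hv, soloInformed_value_kummerBoxRep a b (by omega) (by omega)])
  have e : of r - of (soloInformedKummerRep a) * of (soloInformedKummerRep b) =
      (of r - of (soloInformedKummerBoxRep a b)) +
      (of (soloInformedKummerBoxRep a b) -
        of (soloInformedKummerRep a) * of (soloInformedKummerRep b)) := by abel
  rw [e]
  exact relations.add_mem hE (soloInformed_of_kummerBox_sub_mul_mem_relations a b)

end Summit.KontsevichZagierPeriods.KontsevichZagierPeriods.Theorems
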